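import Summits.QuantumFields.QCD.Theses.DiagonalSpine

/-!
# Crux-ideate sketch (ideator 1, round 1) — crux stmt-QuantumFields-9715
`Summit.QuantumFields.QCD.CruxVerbatim`

First lemmas of the two idea cards:

* `dock-honest-spine`: hypothesis surgery — the crux hypothesis at `N_f` is, definitionally up to two
  `Iff.rfl`s, the "lattice half at `N_f`" (H1–H3) shared by routes DiagonalSpine / GapBuysCauchyRate
  (`cruxHypAt_iff`, `crux_iff`); `DiagonalSpine.LightQuarkGap` reads as "lattice half ⇒ honest lattice
  half (H1–H3 ∧ `IsNonDecoupled`)" (`lightQuarkGap_iff`); and the crux is the checked composition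
  `LightQuarkGap → OSLegFromHonest → ContinuumFromLatticeGap` (`dock`).
* `baire-uniformise-the-gap`: the abstract uniformisation lemma (`eventually_uniform_of_pointwise`),
  a Banach–Steinhaus-type statement for eventually-bounded quadratic families, which turns the
  per-pair constants and per-pair thresholds of `HasLatticeMassGap` into support-uniform product-form
  constants.
-/

namespace Summit.QuantumFields.QCD.Cruxes.ContinuumFromLatticeGap.Ideator1B

/-! ### Variant B (published while the farm is incoherent for `Theses.GluonFreeDual` rev 3): the crux is
restated VERBATIM as `CruxVerbatim` (same text as `GluonFreeDual.ContinuumFromLatticeGap`, which is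
definitionally `∀ Nf, (Nf = 2 ∨ Nf = 3) → CruxHypAt Nf → QCDOf Nf`); the version against the real decl is
the folder file `Sketch.lean` (lean check rc 0, 0 sorry; attached as item evidence). -/

open Filter Topology Set
open Literature.MathematicalPhysics.QuantumFieldTheory Literature.MathematicalPhysics.QuantumLattice
  Literature.MathematicalPhysics.AQFT

/-! ## Card `dock-honest-spine` -/

/-- The crux hypothesis at `N_f`, verbatim (the antecedent of `ContinuumFromLatticeGap`). -/
def CruxHypAt (Nf : ℕ) : Prop :=
  ∃ reg : QCDRegularisation Nf, reg.HasMassScaling ∧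
    (∀ (m : Fin Nf → ℝ) (z shift : QCDField Nf → ℕ → ℝ), (reg.scheme m z shift).HasAsymptoticScaling) ∧
      ∀ m : Fin Nf → ℝ, (∀ f, 0 < m f) →
        (∀ f, ∀ᶠ k in atTop, -1 < (reg.scheme m 0 0).mq f k) ∧
          ∃ Δ : ℝ, 0 < Δ ∧ ∀ z shift : QCDField Nf → ℕ → ℝ, (reg.scheme m z shift).HasLatticeMassGap Δ

/-- The crux `GluonFreeDual.ContinuumFromLatticeGap` (stmt-QuantumFields-9715), restated verbatim. -/
def CruxVerbatim : Prop :=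
  ∀ Nf : ℕ, (Nf = 2 ∨ Nf = 3) → (∃ reg : QCDRegularisation Nf, reg.HasMassScaling ∧ (∀ (m : Fin Nf → ℝ) (z shift : QCDField Nf → ℕ → ℝ), (reg.scheme m z shift).HasAsymptoticScaling) ∧ ∀ m : Fin Nf → ℝ, (∀ f, 0 < m f) → (∀ f, ∀ᶠ k in Filter.atTop, -1 < (reg.scheme m 0 0).mq f k) ∧ ∃ Δ : ℝ, 0 < Δ ∧ ∀ z shift : QCDField Nf → ℕ → ℝ, (reg.scheme m z shift).HasLatticeMassGap Δ) → QCDOf Nf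

/-- The shared "lattice half at `N_f`" (H1 `HasMassScaling`, H2 two-loop asymptotic scaling of the bare
scheme, H3 physical branch + volume-uniform lattice gap for every positive mass tuple) — the shape of
`DiagonalSpine.FullLatticeGap` / `GapBuysCauchyRate.FullLatticeGap` at one `N_f`, and the antecedent of
`DiagonalSpine.LightQuarkGap`. -/
def LatticeHalfAt (Nf : ℕ) : Prop :=
  ∃ reg : QCDRegularisation Nf, reg.HasMassScaling ∧ (reg.scheme 0 0 0).HasAsymptoticScaling ∧
    (∀ m : Fin Nf → ℝ, (∀ f, 0 < m f) →
      (∀ f, ∀ᶠ k in atTop, -1 < (reg.scheme m 0 0).mq f k) ∧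
        ∃ Δ > 0, (reg.scheme m 0 0).HasLatticeMassGap Δ)

/-- The HONEST lattice half at `N_f`: H1–H3 and lattice non-decoupling H4 (`IsNonDecoupled`, ratio
lower bounds under physical time translations) — the consequent of `DiagonalSpine.LightQuarkGap`. -/
def HonestLatticeHalfAt (Nf : ℕ) : Prop :=
  ∃ reg : QCDRegularisation Nf, reg.HasMassScaling ∧ (reg.scheme 0 0 0).HasAsymptoticScaling ∧
    (∀ m : Fin Nf → ℝ, (∀ f, 0 < m f) →
      (∀ f, ∀ᶠ k in atTop, -1 < (reg.scheme m 0 0).mq f k) ∧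
        ∃ Δ > 0, (reg.scheme m 0 0).HasLatticeMassGap Δ) ∧ reg.IsNonDecoupled

/-- Asymptotic scaling of `reg.scheme m z shift` does not depend on `(m, z, shift)`: it reads only
`reg.β`, `reg.a` (projection reduction). -/
theorem hasAsymptoticScaling_scheme_iff {Nf : ℕ} (reg : QCDRegularisation Nf)
    (m m' : Fin Nf → ℝ) (z z' shift shift' : QCDField Nf → ℕ → ℝ) :
    (reg.scheme m z shift).HasAsymptoticScaling ↔ (reg.scheme m' z' shift').HasAsymptoticScaling :=
  Iff.rfl

/-- The lattice gap of `reg.scheme m z shift` does not depend on the species renormalisations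
`(z, shift)`: `HasLatticeMassGap` reads only `a, β, L, mq` (projection reduction). -/
theorem hasLatticeMassGap_scheme_iff {Nf : ℕ} (reg : QCDRegularisation Nf) (m : Fin Nf → ℝ)
    (z z' shift shift' : QCDField Nf → ℕ → ℝ) (Δ : ℝ) :
    (reg.scheme m z shift).HasLatticeMassGap Δ ↔ (reg.scheme m z' shift').HasLatticeMassGap Δ :=
  Iff.rfl

/-- **Hypothesis surgery.** The crux hypothesis at `N_f` is the shared lattice half at `N_f`. -/
theorem cruxHypAt_iff (Nf : ℕ) : CruxHypAt Nf ↔ LatticeHalfAt Nf := by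
  constructor
  · rintro ⟨reg, hMS, hAS, h⟩
    refine ⟨reg, hMS, hAS 0 0 0, fun m hm => ⟨(h m hm).1, ?_⟩⟩
    obtain ⟨Δ, hΔ, hgap⟩ := (h m hm).2
    exact ⟨Δ, hΔ, hgap 0 0⟩
  · rintro ⟨reg, hMS, hAS, h⟩
    refine ⟨reg, hMS, fun m z shift => hAS, fun m hm => ⟨(h m hm).1, ?_⟩⟩
    obtain ⟨Δ, hΔ, hgap⟩ := (h m hm).2
    exact ⟨Δ, hΔ, fun z shift => hgap⟩

/-- The crux, re-read: for `N_f = 2, 3` separately, the shared lattice half implies `QCDOf N_f`. -/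
theorem crux_iff :
    CruxVerbatim ↔
      ∀ Nf : ℕ, (Nf = 2 ∨ Nf = 3) → LatticeHalfAt Nf → QCDOf Nf := by
  change (∀ Nf : ℕ, (Nf = 2 ∨ Nf = 3) → CruxHypAt Nf → QCDOf Nf) ↔ _
  exact forall_congr' fun Nf => by rw [cruxHypAt_iff]

/-- `DiagonalSpine.LightQuarkGap` (stmt-QuantumFields-14656) is literally "lattice half ⇒ honest
lattice half" at each `N_f ∈ {2, 3}`. -/
theorem lightQuarkGap_iff :
    Theses.DiagonalSpine.LightQuarkGap ↔
      ∀ Nf : ℕ, Nf = 2 ∨ Nf = 3 → LatticeHalfAt Nf → HonestLatticeHalfAt Nf :=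
  Iff.rfl

/-- **The OS leg from an HONEST regularisation** (per `N_f`): the content of DiagonalSpine's layer-2
chain after `LightQuarkGap` (RotationRestoration 8840, CalibratedTightness 14675, MassEquicontinuity
14676, DiagonalLemma 8930 + SubsequenceStability 8931, and the OS-closure socket
`GapBuysCauchyRate.ConvergentOSClosure` 11525), stated as ONE implication. It is NOT the crux: its
hypothesis carries H4 = `IsNonDecoupled`, which the crux hypothesis lacks and without which every
calibrated limit may be the vacuum. -/
def OSLegFromHonest : Prop :=
  ∀ Nf : ℕ, (Nf = 2 ∨ Nf = 3) → HonestLatticeHalfAt Nf → QCDOf Nf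

/-- **Dock.** The crux is the composition of the light-quark lattice half (DiagonalSpine's
`LightQuarkGap`, shared) with the OS leg from an honest regularisation. Pure logic. -/
theorem dock (hL : Theses.DiagonalSpine.LightQuarkGap) (hOS : OSLegFromHonest) :
    CruxVerbatim := by
  rw [crux_iff]
  intro Nf hNf hLat
  exact hOS Nf hNf ((lightQuarkGap_iff.mp hL) Nf hNf hLat)

/-- Conversely the crux implies the OS leg from an honest regularisation (drop H4) — so, GIVEN
`LightQuarkGap`, the crux and `OSLegFromHonest` are equivalent: docking relocates, it does not inflate. -/
theorem osLegFromHonest_of_crux (h : CruxVerbatim) : OSLegFromHonest := by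
  rw [crux_iff] at h
  rintro Nf hNf ⟨reg, h1, h2, h3, -⟩
  exact h Nf hNf ⟨reg, h1, h2, h3⟩

/-- The crux also closes DiagonalSpine's frame crux `LatticeToContinuum` (stmt-QuantumFields-8929):
whoever proves 9715 proves 8929. -/
theorem latticeToContinuum_of_crux (h : CruxVerbatim) :
    Theses.DiagonalSpine.LatticeToContinuum := by
  rw [crux_iff] at h
  intro hFull
  exact ⟨h 2 (Or.inl rfl) (hFull 2 (Or.inl rfl)), h 3 (Or.inr rfl) (hFull 3 (Or.inr rfl))⟩

/-! ## Card `baire-uniformise-the-gap` — the abstract first lemma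

A Banach–Steinhaus-type uniformisation for EVENTUALLY bounded QUADRATIC families: if every point of a
Banach space satisfies the family of closed conditions `‖b k j x x‖ ≤ C · w k j` for all `k ≥ k₀(x)` with
its own `(C, k₀)`, then one constant and one threshold serve the whole space in product form. This is
the shape of `QCDScheme.HasLatticeMassGap` (`∀ A B, ∃ C, ∀ᶠ k, ∀ S ≥ L_k, ∀ n ≤ S, …`) read on the
Banach space of bounded cylinder observables of a fixed support, `w k (S, n) = exp (−Δ a_k n)`. -/

/-- **Uniformisation lemma (PROVED): Baire category on `X × X` + four-point polarisation +
scaling.** Pointwise-in-the-pair constants AND thresholds become one constant, one threshold, in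
product form. -/
theorem eventually_uniform_of_pointwise {X : Type*} [NormedAddCommGroup X] [NormedSpace ℝ X]
    [CompleteSpace X] {J : Type*} (b : ℕ → J → X →L[ℝ] X →L[ℝ] ℝ) (w : ℕ → J → ℝ)
    (hw : ∀ k j, 0 < w k j)
    (h : ∀ x y : X, ∃ C : ℝ, ∃ N : ℕ, ∀ k ≥ N, ∀ j, |b k j x y| ≤ C * w k j) :
    ∃ K : ℝ, ∃ N : ℕ, ∀ k ≥ N, ∀ j, ∀ x y : X, |b k j x y| ≤ K * ‖x‖ * ‖y‖ * w k j := by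
  -- the closed sets of the Baire argument
  let E : ℕ → Set (X × X) := fun N => {p | ∀ k ≥ N, ∀ j, |b k j p.1 p.2| ≤ N * w k j}
  have hE : ∀ N, IsClosed (E N) := by
    intro N
    have hEq : E N = ⋂ k, ⋂ (_ : N ≤ k), ⋂ j, {p : X × X | |b k j p.1 p.2| ≤ N * w k j} := by
      ext p; simp [E]
    rw [hEq]
    refine isClosed_iInter fun k => isClosed_iInter fun _ => isClosed_iInter fun j => ?_
    exact isClosed_le (continuous_abs.comp (b k j).continuous₂) continuous_const
  have hU : (⋃ N, E N) = univ := by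
    ext p
    simp only [mem_iUnion, mem_univ, iff_true]
    obtain ⟨C, N, hN⟩ := h p.1 p.2
    refine ⟨max N ⌈C⌉₊, fun k hk j => (hN k ((le_max_left _ _).trans hk) j).trans ?_⟩
    have hC : C ≤ ((max N ⌈C⌉₊ : ℕ) : ℝ) :=
      (Nat.le_ceil C).trans (by exact_mod_cast le_max_right _ _)
    exact mul_le_mul_of_nonneg_right hC (hw k j).le
  obtain ⟨N, p₀, hp₀⟩ := nonempty_interior_of_iUnion_of_closed hE hU
  rw [mem_interior_iff_mem_nhds, Metric.mem_nhds_iff] at hp₀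
  obtain ⟨r, hr, hball⟩ := hp₀
  -- membership of translated pairs in the good set
  have mem : ∀ u v : X, ‖u‖ < r → ‖v‖ < r → (p₀.1 + u, p₀.2 + v) ∈ E N := by
    intro u v hu hv
    apply hball
    rw [Metric.mem_ball, Prod.dist_eq, dist_eq_norm, dist_eq_norm]
    simpa using ⟨hu, hv⟩
  -- four-point polarisation: small pairs are uniformly bounded
  have key : ∀ k ≥ N, ∀ j, ∀ u v : X, ‖u‖ < r → ‖v‖ < r → |b k j u v| ≤ 4 * N * w k j := by
    intro k hk j u v hu hv
    have h0 : ‖(0 : X)‖ < r := by simpa using hr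
    have h1 := abs_le.mp (mem u v hu hv k hk j)
    have h2 := abs_le.mp (mem u 0 hu h0 k hk j)
    have h3 := abs_le.mp (mem 0 v h0 hv k hk j)
    have h4 := abs_le.mp (mem 0 0 h0 h0 k hk j)
    simp only [add_zero] at h1 h2 h3 h4
    have expand : b k j u v =
        b k j (p₀.1 + u) (p₀.2 + v) - b k j (p₀.1 + u) p₀.2 - b k j p₀.1 (p₀.2 + v) + b k j p₀.1 p₀.2 := by
      simp [map_add]; try ring
    rw [expand, abs_le]
    constructor <;> linarith [h1.1, h1.2, h2.1, h2.2, h3.1, h3.2, h4.1, h4.2]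
  -- scaling
  refine ⟨16 * N / r ^ 2, N, fun k hk j x y => ?_⟩
  have hwk := (hw k j).le
  by_cases hx : x = 0
  · simp [hx]
  by_cases hy : y = 0
  · simp [hy]
  have hxn : 0 < ‖x‖ := norm_pos_iff.mpr hx
  have hyn : 0 < ‖y‖ := norm_pos_iff.mpr hy
  set cx : ℝ := r / (2 * ‖x‖) with hcx
  set cy : ℝ := r / (2 * ‖y‖) with hcy
  have hcxpos : 0 < cx := by positivity
  have hcypos : 0 < cy := by positivity
  have hu : ‖cx • x‖ < r := by
    rw [norm_smul, Real.norm_of_nonneg hcxpos.le, hcx, div_mul_eq_mul_div,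
      mul_div_mul_right r 2 hxn.ne']
    linarith
  have hv : ‖cy • y‖ < r := by
    rw [norm_smul, Real.norm_of_nonneg hcypos.le, hcy, div_mul_eq_mul_div,
      mul_div_mul_right r 2 hyn.ne']
    linarith
  have hb : b k j (cx • x) (cy • y) = (cx * cy) * b k j x y := by
    simp [map_smul]; ring
  have hkey := key k hk j (cx • x) (cy • y) hu hv
  rw [hb, abs_mul, abs_of_pos (mul_pos hcxpos hcypos)] at hkey
  -- hkey : cx * cy * |b x y| ≤ 4 N w, with cx * cy = r² / (4 ‖x‖ ‖y‖)
  have hcc : cx * cy = r ^ 2 / (4 * (‖x‖ * ‖y‖)) := by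
    rw [hcx, hcy]; field_simp; ring
  rw [hcc] at hkey
  have hpos : 0 < r ^ 2 / (4 * (‖x‖ * ‖y‖)) := by positivity
  have hfin : |b k j x y| ≤ 4 * N * w k j / (r ^ 2 / (4 * (‖x‖ * ‖y‖))) := by
    rw [le_div_iff₀ hpos]
    simpa [mul_comm] using hkey
  calc |b k j x y| ≤ 4 * N * w k j / (r ^ 2 / (4 * (‖x‖ * ‖y‖))) := hfin
    _ = 16 * N / r ^ 2 * ‖x‖ * ‖y‖ * w k j := by
      field_simp
      ring

end Summit.QuantumFields.QCD.Cruxes.ContinuumFromLatticeGap.Ideator1B
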